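import Summits.Schanuel.Schanuel.Theorems.ZilberEacParamConstFibreWitness
import Summits.Schanuel.Schanuel.Theorems.ZilberEacParamRamifiedTrichotomy
import HarnessLib

/-!
# Polynomially parametrised base curves, LXXXI: constant fibres — GROWTH in a direction at
# infinity, and the coefficient structure it leaves (`Π ∈ ℂ + iℝ[u^d]`)

HONEST FRAMING.  Cell `pub-schanuel` (Zilber's Exponential-Algebraic Closedness, case ladder;
host summit Schanuel), seat 2, gen 27.  For the constant-fibre cylinder
`S = {(g₀(t), g₁(t))} × {y₀ = θ} × ℂ` over a polynomial curve, file LXXX gives, in each direction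
`ζ` (`ζ^d = ±1`, `d = deg g₀`), exponential points with `g₁(t_j) = Π(ζ⁻¹ u_j) + r(μ_j)`,
`u_j = (m₀ + j)^{1/d}`.  This file:
* **`exists_rePolyDir`** — the real polynomial `R_ζ(u) = Σ_i Re(Π_i ζ^{-i}) u^i` with
  `Re Π(ζ⁻¹u) = R_ζ(u)` for real `u` (constant only if `Re(Π_i ζ^{-i}) = 0` for all `i ≥ 1`);
* **`unprojectedDense_constFibre_of_growth`** — if `deg R_ζ ≥ 1` then `I(S ∩ Γ_exp) = I(S)`: along
  the sub-family of `d`-th-power labels `(m₀ + i)^d` one has `u = m₀ + i`, so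
  `|Re g₁(t)| / log ‖g₁(t)‖ → ∞` and THEOREM G (`unprojectedDense_of_growth`) applies;
* **`coeff_eq_zero_of_re_dirs`** — if `R_1` and `R_{ζ₁}` are both constant for
  `ζ₁ = e^{iπ/d}` (`ζ₁^d = -1`), then `Π_i = 0` for every `i ≥ 1` with `d ∤ i` (and `Π_i ∈ iℝ` for
  all `i ≥ 1`): `Re Π_i = 0` and `Re(Π_i e^{-iπ i/d}) = Im(Π_i) sin(π i/d) = 0`;
* **`eval_eq_eval_contract_pow`** — then `Π(u) = Π̃(u^d)` with `Π̃ = contract d Π`, so along the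
  direction `ζ = 1` the phases `Π(u_j) = Π̃(m₀ + j)` are POLYNOMIAL in the label.
[folklore]; nothing here is specific to Schanuel's conjecture (neither used nor implied);
Mantova–Masser's question (PLMS 2024 §1 p. 5) and EC(3,2) stay OPEN.
-/

noncomputable section

open Filter Topology Set Complex MvPolynomial
open Literature.NumberTheory.Transcendental Literature.ModelTheory.Zilber
open Literature.ModelTheory.ExponentialFields

set_option linter.dupNamespace false

namespace Summit.Schanuel.Schanuel.Theorems

/-! ## Part A. The real part of `Π(ζ⁻¹ u)` as a real polynomial in `u` -/

/-- **The real part of `Π(ζ⁻¹ u)` is a real polynomial `R_ζ(u) = Σ_i Re(Π_i ζ^{-i}) u^i` in the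
real variable `u`**, and if `R_ζ` is constant then `Re(Π_i ζ^{-i}) = 0` for all `i ≥ 1`.
[folklore] -/
theorem exists_rePolyDir (Pl : Polynomial ℂ) (ζ : ℂ) :
    ∃ R : Polynomial ℝ, (∀ u : ℝ, (Pl.eval (ζ⁻¹ * (u : ℂ))).re = R.eval u) ∧
      (R.natDegree = 0 → ∀ i, 1 ≤ i → (Pl.coeff i * ζ⁻¹ ^ i).re = 0) := by
  classical
  set R : Polynomial ℝ := ∑ i ∈ Finset.range (Pl.natDegree + 1),
    Polynomial.C ((Pl.coeff i * ζ⁻¹ ^ i).re) * Polynomial.X ^ i with hR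
  have hcoeff : ∀ i, i ≤ Pl.natDegree → R.coeff i = (Pl.coeff i * ζ⁻¹ ^ i).re := by
    intro i hi
    rw [hR, Polynomial.finsetSum_coeff]
    simp only [Polynomial.coeff_C_mul_X_pow]
    rw [Finset.sum_ite_eq (Finset.range (Pl.natDegree + 1)) i
      (fun j => (Pl.coeff j * ζ⁻¹ ^ j).re), if_pos (Finset.mem_range.2 (Nat.lt_succ_of_le hi))]
  refine ⟨R, fun u => ?_, fun h i hi => ?_⟩
  · rw [Polynomial.eval_eq_sum_range, Complex.re_sum, hR, Polynomial.eval_finsetSum]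
    refine Finset.sum_congr rfl fun i _ => ?_
    rw [Polynomial.eval_mul, Polynomial.eval_C, Polynomial.eval_pow, Polynomial.eval_X, mul_pow,
      ← mul_assoc, ← Complex.ofReal_pow, Complex.re_mul_ofReal]
  · by_cases hle : i ≤ Pl.natDegree
    · rw [← hcoeff i hle]
      exact Polynomial.coeff_eq_zero_of_natDegree_lt (by omega)
    · rw [Polynomial.coeff_eq_zero_of_natDegree_lt (by omega), zero_mul, Complex.zero_re]

/-! ## Part B. Growth in a direction gives density -/

section Growth

variable (g₀ g₁ : Polynomial ℂ) {Q : MvPolynomial (Fin 3) ℂ}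

/-- If `Q(t; y₀, y₁)` vanishes identically in `t, y₁` at `y₀ = θ`, the points
`(g₀(t), g₁(t), θ, e^{g₁(t)})` with `e^{g₀(t)} = θ` are exponential points of `S(g; Q)`. [folklore] -/
theorem constFibre_point_mem {θ : ℂ}
    (hθ : ∀ t y : ℂ, MvPolynomial.eval ![t, θ, y] Q = 0) {t : ℂ} (ht : Complex.exp (g₀.eval t) = θ) :
    (Sum.elim ![g₀.eval t, g₁.eval t] ![θ, Complex.exp (g₁.eval t)] : Fin 2 ⊕ Fin 2 → ℂ) ∈
      {w : Fin 2 ⊕ Fin 2 → ℂ | ∃ t : ℂ, w (Sum.inl 0) = g₀.eval t ∧ w (Sum.inl 1) = g₁.eval t ∧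
        MvPolynomial.eval (Fin.cases t (fun i => w (Sum.inr i)) : Fin 3 → ℂ) Q = 0} ∩
      expGraph ℂ 2 := by
  refine ⟨⟨t, by simp, by simp, ?_⟩, ?_⟩
  · have e : (Fin.cases t (fun i => (Sum.elim ![g₀.eval t, g₁.eval t]
        ![θ, Complex.exp (g₁.eval t)] : Fin 2 ⊕ Fin 2 → ℂ) (Sum.inr i)) : Fin 3 → ℂ) =
        ![t, θ, Complex.exp (g₁.eval t)] := by
      funext i
      refine Fin.cases ?_ (fun j => ?_) i
      · rfl
      · simp only [Fin.cases_succ]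
        fin_cases j <;> simp
    rw [e]; exact hθ t _
  · rw [mem_expGraph_iff]
    intro i
    rw [Literature.ModelTheory.ExponentialFields.ExponentialRing.complex_exp_eq]
    fin_cases i <;> simp [ht]

/-- **Growth in a direction `ζ` gives density** for the constant-fibre cylinder.  Along the family
of file LXXX in direction `ζ` (`‖ζ‖ = 1`), `g₁(t_j) = Π(μ_j⁻¹) + r(μ_j)` with
`μ_j = ζ (m₀ + j)^{-1/d}`; if the real polynomial `R_ζ` has degree `≥ 1`, then
`I(S ∩ Γ_exp) = I(S)`. [cite: MantovaMasser2023, §1 Further remarks, p. 5 (the question, open in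
general)] (new) -/
theorem unprojectedDense_constFibre_of_growth (hg₀ : 1 ≤ g₀.natDegree) (hirr : Irreducible Q)
    {θ : ℂ} (hθ : ∀ t y : ℂ, MvPolynomial.eval ![t, θ, y] Q = 0) (Pl : Polynomial ℂ) {ζ : ℂ}
    (hζ : ‖ζ‖ = 1) {r : ℂ → ℂ} (hr : AnalyticAt ℂ r 0) {m₀ : ℕ} {μ t : ℕ → ℂ}
    (hμ : ∀ j, μ j = ζ * ((((m₀ + j : ℕ) : ℝ) ^ ((g₀.natDegree : ℝ)⁻¹) : ℝ) : ℂ)⁻¹)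
    (hμlim : Tendsto μ atTop (𝓝 0)) (hexp : ∀ j, Complex.exp (g₀.eval (t j)) = θ)
    (hid₁ : ∀ j, g₁.eval (t j) = Pl.eval ((μ j)⁻¹) + r (μ j))
    {R : Polynomial ℝ} (hRζ : ∀ u : ℝ, (Pl.eval (ζ⁻¹ * (u : ℂ))).re = R.eval u)
    (hdeg : 1 ≤ R.natDegree) :
    UnprojectedDense {w : Fin 2 ⊕ Fin 2 → ℂ | ∃ t : ℂ, w (Sum.inl 0) = g₀.eval t ∧
      w (Sum.inl 1) = g₁.eval t ∧
      MvPolynomial.eval (Fin.cases t (fun i => w (Sum.inr i)) : Fin 3 → ℂ) Q = 0} := by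
  classical
  set d := g₀.natDegree with hdd
  have hd0 : d ≠ 0 := by omega
  have hζ0 : ζ ≠ 0 := norm_pos_iff.1 (by rw [hζ]; exact one_pos)
  -- the sub-family of `d`-th-power labels: `m₀ + φ i = (m₀ + i)^d`, `μ_{φ i}⁻¹ = ζ⁻¹ (m₀ + i)`
  have hpow : ∀ i, m₀ ≤ (m₀ + i) ^ d := fun i =>
    (Nat.le_add_right m₀ i).trans (Nat.le_self_pow hd0 _)
  set φ : ℕ → ℕ := fun i => (m₀ + i) ^ d - m₀ with hφ
  have hφlab : ∀ i, m₀ + φ i = (m₀ + i) ^ d := fun i => by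
    change m₀ + ((m₀ + i) ^ d - m₀) = (m₀ + i) ^ d
    have := hpow i
    omega
  have hμφ : ∀ i, (μ (φ i))⁻¹ = ζ⁻¹ * ((m₀ + i : ℕ) : ℂ) := by
    intro i
    rw [hμ (φ i), hφlab i, mul_inv, inv_inv]
    congr 1
    rw [Nat.cast_pow, Real.pow_rpow_inv_natCast (Nat.cast_nonneg _) hd0, Complex.ofReal_natCast]
  -- the surface and the points
  have hS := isIrreducibleClosed_paramSurface₃ g₀ g₁ hg₀ hirr
  have hdim := zariskiDim_paramSurface₃ g₀ g₁ hg₀ hirr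
  set q : ℕ → Fin 2 ⊕ Fin 2 → ℂ := fun i =>
    Sum.elim ![g₀.eval (t (φ i)), g₁.eval (t (φ i))] ![θ, Complex.exp (g₁.eval (t (φ i)))] with hq
  have hqSΓ : ∀ i, q i ∈ {w : Fin 2 ⊕ Fin 2 → ℂ | ∃ t : ℂ, w (Sum.inl 0) = g₀.eval t ∧
      w (Sum.inl 1) = g₁.eval t ∧
      MvPolynomial.eval (Fin.cases t (fun i => w (Sum.inr i)) : Fin 3 → ℂ) Q = 0} ∩ expGraph ℂ 2 :=
    fun i => constFibre_point_mem g₀ g₁ hθ (hexp (φ i))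
  -- the real parts: `Re g₁(t_{φ i}) = R_ζ(m₀ + i) + Re r(μ_{φ i})`
  have hcast : ∀ i, ((m₀ + i : ℕ) : ℂ) = (((m₀ + i : ℕ) : ℝ) : ℂ) := fun i => by
    rw [Complex.ofReal_natCast]
  have hre : ∀ i, (g₁.eval (t (φ i))).re = R.eval ((m₀ + i : ℕ) : ℝ) + (r (μ (φ i))).re := by
    intro i
    rw [hid₁, hμφ i, Complex.add_re, hcast, hRζ]
  have hrlim : Tendsto (fun i => r (μ (φ i))) atTop (𝓝 (r 0)) := by
    have hφtop : Tendsto φ atTop atTop := by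
      refine tendsto_atTop_mono (fun i => ?_) tendsto_id
      change i ≤ φ i
      have h1 := hφlab i
      have h2 : m₀ + i ≤ (m₀ + i) ^ d := Nat.le_self_pow hd0 _
      omega
    exact hr.continuousAt.tendsto.comp (hμlim.comp hφtop)
  obtain ⟨M, hM⟩ : ∃ M : ℝ, ∀ i, ‖r (μ (φ i))‖ ≤ M := by
    obtain ⟨C, hC⟩ := isBounded_iff_forall_norm_le.1 (Metric.isBounded_range_of_tendsto _ hrlim)
    exact ⟨C, fun i => hC _ ⟨i, rfl⟩⟩
  have hM0 : 0 ≤ M := (norm_nonneg _).trans (hM 0)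
  have ha : ∀ i, |(g₁.eval (t (φ i))).re - R.eval ((m₀ + i : ℕ) : ℝ)| ≤ M := by
    intro i
    rw [hre i, add_sub_cancel_left]
    exact (Complex.abs_re_le_norm _).trans (hM i)
  -- the denominator
  obtain ⟨D, hD, hLD⟩ := log_two_add_norm_eval_le_log_label Pl (le_refl (0 : ℝ))
  have hLD' : ∀ i, Real.log (2 + ‖g₁.eval (t (φ i))‖) ≤
      (D + Real.log (1 + M)) * Real.log (3 + 3 * ((m₀ + i : ℕ) : ℝ)) := by
    intro i
    have hlab0 : (0 : ℝ) ≤ ((m₀ + i : ℕ) : ℝ) := Nat.cast_nonneg _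
    have h1 : Real.log (2 + ‖Pl.eval (ζ⁻¹ * ((m₀ + i : ℕ) : ℂ))‖) ≤
        D * Real.log (3 + 3 * ((m₀ + i : ℕ) : ℝ)) := by
      refine hLD _ _ hlab0 ?_
      rw [norm_mul, norm_inv, hζ, inv_one, one_mul, Complex.norm_natCast, zero_add]
      linarith
    have h2 : ‖g₁.eval (t (φ i))‖ ≤ ‖Pl.eval (ζ⁻¹ * ((m₀ + i : ℕ) : ℂ))‖ + M := by
      rw [hid₁, hμφ i]
      exact (norm_add_le _ _).trans (by linarith [hM i])
    calc Real.log (2 + ‖g₁.eval (t (φ i))‖)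
        ≤ Real.log (2 + ‖Pl.eval (ζ⁻¹ * ((m₀ + i : ℕ) : ℂ))‖ + M) :=
          Real.log_le_log (by positivity) (by linarith)
      _ ≤ (D + Real.log (1 + M)) * Real.log (3 + 3 * ((m₀ + i : ℕ) : ℝ)) :=
          log_two_add_add_le (norm_nonneg _) hM0 (one_le_log_three_add _ hlab0) h1
  have hD' : 0 < D + Real.log (1 + M) := by
    have := Real.log_nonneg (by linarith : (1 : ℝ) ≤ 1 + M)
    linarith
  have hgr : Tendsto (fun i => |(g₁.eval (t (φ i))).re| / Real.log (2 + ‖g₁.eval (t (φ i))‖))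
      atTop atTop :=
    tendsto_abs_div_log_of_linear_growth hdeg m₀ hD' ha
      (fun i => Real.log_le_log two_pos (by linarith [norm_nonneg (g₁.eval (t (φ i)))])) hLD'
  refine unprojectedDense_of_growth hS (le_of_eq hdim) 1 (fun i => (hqSΓ i).1) (fun i => (hqSΓ i).2) ?_
  refine hgr.congr fun i => ?_
  simp [hq]

end Growth

/-! ## Part C. Two directions without growth: the coefficient structure of `Π` -/

/-- `ζ₁ = e^{iπ/d}` has `ζ₁^d = -1` and `‖ζ₁‖ = 1`. [folklore] -/
theorem halfTurnRoot_pow (d : ℕ) (hd : d ≠ 0) :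
    Complex.exp (((Real.pi / d : ℝ) : ℂ) * I) ^ d = ((-1 : ℤ) : ℂ) ∧
      ‖Complex.exp (((Real.pi / d : ℝ) : ℂ) * I)‖ = 1 := by
  refine ⟨?_, by rw [Complex.norm_exp_ofReal_mul_I]⟩
  rw [← Complex.exp_nat_mul, ← mul_assoc, ← Complex.ofReal_natCast, ← Complex.ofReal_mul,
    mul_div_cancel₀ _ (Nat.cast_ne_zero.2 hd : (d : ℝ) ≠ 0), Complex.exp_pi_mul_I]
  simp

/-- **No growth in the directions `1` and `e^{iπ/d}` forces `Π_i = 0` for `d ∤ i`, `i ≥ 1`.**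
[folklore] -/
theorem coeff_eq_zero_of_re_dirs (Pl : Polynomial ℂ) {d : ℕ} (hd : d ≠ 0)
    (h1 : ∀ i, 1 ≤ i → (Pl.coeff i * (1 : ℂ)⁻¹ ^ i).re = 0)
    (h2 : ∀ i, 1 ≤ i → (Pl.coeff i * (Complex.exp (((Real.pi / d : ℝ) : ℂ) * I))⁻¹ ^ i).re = 0)
    {i : ℕ} (hi : 1 ≤ i) (hdi : ¬ d ∣ i) : Pl.coeff i = 0 := by
  have hre : (Pl.coeff i).re = 0 := by simpa using h1 i hi
  -- `ζ₁^{-i} = e^{-iπ i/d}`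
  have hpow : (Complex.exp (((Real.pi / d : ℝ) : ℂ) * I))⁻¹ ^ i =
      Complex.exp (((-(Real.pi * i / d) : ℝ) : ℂ) * I) := by
    rw [← Complex.exp_neg, ← Complex.exp_nat_mul]
    congr 1
    push_cast
    ring
  have h := h2 i hi
  rw [hpow, Complex.mul_re, Complex.exp_ofReal_mul_I_re, Complex.exp_ofReal_mul_I_im, hre, zero_mul,
    zero_sub, neg_eq_zero, Real.sin_neg, mul_neg, neg_eq_zero] at h
  rcases mul_eq_zero.1 h with him | hsin
  · exact Complex.ext (by simpa using hre) (by simpa using him)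
  · exfalso
    obtain ⟨n, hn⟩ := Real.sin_eq_zero_iff.1 hsin
    have hdR : (d : ℝ) ≠ 0 := Nat.cast_ne_zero.2 hd
    have hn' : (n : ℝ) * d = i := by
      have h3 : (n : ℝ) * Real.pi * d = Real.pi * i := by
        rw [hn, div_mul_cancel₀ _ hdR]
      have h4 : ((n : ℝ) * d - i) * Real.pi = 0 := by linear_combination h3
      rcases mul_eq_zero.1 h4 with h5 | h5
      · linarith
      · exact absurd h5 Real.pi_ne_zero
    have hn'' : (n * d : ℤ) = (i : ℤ) := by exact_mod_cast hn'
    exact hdi (Int.natCast_dvd_natCast.1 ⟨n, by rw [← hn'']; ring⟩)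

/-- **`Π(u) = Π̃(u^d)`** when `Π_i = 0` for all `i ≥ 1` with `d ∤ i`, with `Π̃ = contract d Π`.
[folklore] -/
theorem eval_eq_eval_contract_pow (Pl : Polynomial ℂ) {d : ℕ} (hd : d ≠ 0)
    (h : ∀ i, 1 ≤ i → ¬ d ∣ i → Pl.coeff i = 0) (u : ℂ) :
    Pl.eval u = (Polynomial.contract d Pl).eval (u ^ d) := by
  have hexp : Polynomial.expand ℂ d (Polynomial.contract d Pl) = Pl := by
    ext n
    rw [Polynomial.coeff_expand (Nat.pos_of_ne_zero hd), Polynomial.coeff_contract hd]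
    split_ifs with hdn
    · rw [Nat.div_mul_cancel hdn]
    · rcases Nat.eq_zero_or_pos n with hn | hn
      · exact absurd (hn ▸ dvd_zero d) hdn
      · exact (h n hn hdn).symm
  conv_lhs => rw [← hexp]
  rw [Polynomial.expand_eval]

end Summit.Schanuel.Schanuel.Theorems
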